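import Literature.NumberTheory.EllipticCurves.LeadingTermPPartProofs
import Literature.NumberTheory.EllipticCurves.BSDRootNumberSmallConductorProofs
import Literature.NumberTheory.EllipticCurves.TamagawaFiniteIndexProofs
import HarnessLib

/-!
# The rank-`0` `p`-part of BSD from Mazur's main conjecture, torsion allowed (Eisenstein primes)

`Proofs` companion (theorems only; no new definition, no new named fact — D-0014/D-0026) of
`Literature.NumberTheory.EllipticCurves.LeadingTerm` (bsd.S30, print shape
`ord_p(L(E,1)/Ω_E) = ord_p(#Ш · ∏ c_ℓ / #E(ℚ)_tors²)`) and `PAdicBSD` (bsd.S21, the cyclotomic main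
conjecture). It records, sorry-free, the deduction printed as the proof of
Castella–Grossi–Lee–Skinner, Invent. Math. 227 (2022), Thm. 5.1.4 (arXiv:2008.02571, §5.1.3,
"A result of Greenberg–Vatsal"): for an elliptic curve `A/ℚ` and a prime `p > 2` of good ordinary
reduction with `L(A,1) ≠ 0`,
"By [Kolyvagin], `rank_ℤ A(ℚ) = 0` and `#Ш(A/ℚ) < ∞` … by [Greenberg, LNM 1716, Thm. 4.1] we
therefore have `#ℤ_p/𝓕_A(0) = #(ℤ_p/((1 - a_p(A) + p)² · #Ш(A/ℚ) · Tam(A/ℚ))) / #(ℤ_p/(#A(ℚ)_tors)²)`,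
where `𝓕_A ∈ Λ_cyc` is a generator of the characteristic ideal of the dual Selmer group … the
cyclotomic main conjecture for `A`, i.e., the equality `(𝓕_A) = (𝓛_A) ⊂ Λ_cyc` where `𝓛_A` is the
`p`-adic `L`-function of Mazur–Swinnerton-Dyer … By the interpolation property of `𝓛_A`,
`𝓛_A(0) = (1 - α_p⁻¹)² · L(A,1)/Ω_A` … Noting that `ord_p(1 - a_p(A) + p) = ord_p(1 - α_p⁻¹)`, the
result thus follows" — with the main conjecture for THIS curve and prime taken as an explicit
hypothesis `hMC` instead of being derived from [GV00] (so that the theorem serves every source of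
the main conjecture: Greenberg–Vatsal 2000 Thm. 1.3 under (GV), Castella–Grossi–Skinner 2025 Thm. 1
under `φ|_{G_p} ≠ 1, ω`, or an OPEN hypothesis at anomalous Eisenstein primes, see
`Literature/NumberTheory/EllipticCurves/KellerYin2024/EisensteinChain.lean`).

Compared with the tree's `padicValRat_bsd_rank_zero_of_mainConjecture` (same file family, whose
proof this one follows line by line): (i) no irreducibility / surjectivity / auxiliary-prime
hypothesis — they entered only through Skinner–Urban's main conjecture and through the `p`-adic
unit `ϖ = Ω⁺_f/Ω_E`; (ii) the main conjecture is taken in MAZUR's normalisation by the Néron period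
`Ω_E` (`char_Λ X(E/ℚ_∞) = (ϖ · L_p(f, α))` with `ϖ · Ω_E = Ω⁺_f`, cf. the table "Normalisations" in
the module docstring of `PAdicBSD`: `L_p^{MTT}(E,T) = ϖ · padicLFunction f α`), which is the form
that is isogeny-invariant and the form proved by Greenberg–Vatsal and Castella–Grossi–Skinner at
Eisenstein primes, where `ϖ` need NOT be a `p`-adic unit; (iii) the torsion term
`2 · ord_p #E(ℚ)_tors` is genuinely present (a rational `p`-torsion point is allowed), exactly as in
Greenberg's Thm. 4.1 (`|E(F)_p|²`) and in Keller–Yin's statement of the `p`-part of BSD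
(arXiv:2402.12781v2, Thm. 4.2.1). Greenberg's Thm. 4.1 enters INLINE (`hGr`, the same spelling as in
`padicValRat_bsd_rank_zero_of_mainConjecture`; no `def … : Prop` is minted), and modularity with an
integral Manin constant as the named fact `nonempty_modularParametrizationData`.

## References

* F. Castella, G. Grossi, J. Lee, C. Skinner, Invent. Math. 227 (2022) 517–580 = arXiv:2008.02571,
  Thm. 5.1.4 and its proof (§5.1.3). [CastellaEtAl2021]
* R. Greenberg, *Iwasawa theory for elliptic curves*, LNM 1716 (1999), Thm. 4.1 (p. 102), proof of
  Lemma 4.2 (p. 103), Lemma 3.1. [GreenbergLNM1716]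
* R. Greenberg, V. Vatsal, Invent. Math. 142 (2000), Thm. 1.3, §3. [GreenbergVatsal2000]
* B. Mazur, J. Tate, J. Teitelbaum, Invent. Math. 84 (1986), §I.14. [MazurTateTeitelbaum1986Invent]
-/

set_option autoImplicit false

noncomputable section

open scoped Classical MatrixGroups ModularForm

open CongruenceSubgroup WeierstrassCurve Literature.NumberTheory.EllipticCurves.ModularForms

namespace Literature.NumberTheory.EllipticCurves

section EisensteinRankZero

/-- **The rank-`0` `p`-part of BSD from Mazur's main conjecture (Néron normalisation), torsion
allowed** — Castella–Grossi–Lee–Skinner 2022, proof of Thm. 5.1.4, as glue. Let `W` be a globally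
minimal model of `E/ℚ`, `p` a prime of good ordinary reduction (`hgood`, `hord : p ∤ a_p`; Greenberg's
input below is printed for odd `p`, LNM 1716 p. 105),
`L(E,1) ≠ 0` (`hL`) and `Ш(E/ℚ)` finite (`hfin`; in analytic rank `0` this is Kolyvagin's theorem,
bsd.S17). Assume modularity with an integral Manin constant (`hmod`, named fact), Greenberg's
Euler-characteristic formula LNM 1716 Thm. 4.1 for `(E, p)` (`hGr`, inline: for the cyclotomic
`ℤ_p`-extension with a topological generator matching the cyclotomic variable, `X(E/ℚ_∞)` torsion
with `char = (f_E)` and `Sel_{p^∞}(E/ℚ)` finite,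
`f_E(0) · #E(ℚ)(p)² ∼ p^{ord_p ∏ c_ℓ} · #Ẽ(𝔽_p)(p)² · #Sel_{p^∞}(E/ℚ)`), and MAZUR'S MAIN CONJECTURE for
`(E, p)` in the Néron normalisation (`hMC`, inline: for every such `(κ, γ)`, the newform `f` of `E`
at level `N_E`, the rational `ϖ` with `ϖ · Ω_E = Ω⁺_f` and every Pontryagin-dual datum `D`,
`X = D.X` is `Λ`-torsion and `char_Λ X = (g)` with `ι g = ϖ · L_p(f, α)`, `α = unitRoot W p`).
Then `L(E,1)/Ω_E` is a rational number `q` with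
`ord_p q = ord_p #Ш(E) + ord_p ∏_ℓ c_ℓ - 2 ord_p #E(ℚ)_tors`.
Chain (loc. cit.): `g(0) = ϖ (1 - α⁻¹)² [0]⁺_f = (1 - α⁻¹)² q` (interpolation,
`constantCoeff_padicLFunction_unitRoot`); `g(0) ≠ 0` hence `Sel_{p^∞}(E/ℚ)` and `E(ℚ)` finite
(Greenberg p. 103, `SelmerDualData.finite_selmerGroupPInfty_of_constantCoeff_ne_zero`); Greenberg's
identity; `1 - α⁻¹ ∼ #Ẽ(𝔽_p) ∼ #Ẽ(𝔽_p)(p)` cancels the anomalous factor (`exists_unit_one_sub_unitRoot_inv`,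
valid also when `p ∣ #Ẽ(𝔽_p)`); `#Sel_{p^∞}(E/ℚ) = #Ш[p^∞] ∼ #Ш`, `#E(ℚ)(p) ∼ #E(ℚ)_tors`.
[cite: CastellaEtAl2021, Thm. 5.1.4 and its proof (§5.1.3)]
[cite: GreenbergLNM1716, Thm. 4.1 (p. 102), proof of Lemma 4.2 (p. 103)] -/
theorem padicValRat_bsd_rank_zero_of_mazurMainConjecture
    (W : WeierstrassCurve ℚ) [W.IsElliptic] [W.IsGloballyMinimal] (p : ℕ) [Fact p.Prime]
    (hgood : W.HasGoodReductionAtPrime p) (hord : ¬ (p : ℤ) ∣ W.frobeniusTrace p)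
    (hL : W.entireLFunction 1 ≠ 0) (hfin : Finite W.sha)
    (hmod : nonempty_modularParametrizationData)
    (hGr : ∀ (κ : ZpExtension ℚ p) (γ : Field.absoluteGaloisGroup ℚ),
        κ.IsCyclotomic → κ.IsTopGenerator γ → IsCyclotomicVariable p γ →
      ∀ (D : W.SelmerDualData κ γ) [Module.Finite (IwasawaAlgebra p) D.X], D.IsTorsion →
      ∀ (fE : IwasawaAlgebra p), D.charIdeal = Ideal.span {fE} →
        Finite (W.selmerGroupPInfty p) →
        ∃ u : ℤ_[p]ˣ,
          ((PowerSeries.constantCoeff fE : ℤ_[p]) : ℚ_[p]) *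
              (Nat.card (AddCommGroup.primaryComponent W.toAffine.Point p) : ℚ_[p]) ^ 2 =
            ((u : ℤ_[p]) : ℚ_[p]) * (p : ℚ_[p]) ^ (padicValNat p W.tamagawaProduct) *
              (Nat.card (AddCommGroup.primaryComponent
                ((integralModelInt W).map (Int.castRingHom (ZMod p))).toAffine.Point p) : ℚ_[p]) ^ 2 *
              (Nat.card (W.selmerGroupPInfty p) : ℚ_[p]))
    (hMC : ∀ (κ : ZpExtension ℚ p) (γ : Field.absoluteGaloisGroup ℚ),
        κ.IsCyclotomic → κ.IsTopGenerator γ → IsCyclotomicVariable p γ →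
      ∀ [NeZero (W.conductorNorm ℤ)] (f : CuspForm (Gamma0 (W.conductorNorm ℤ)) 2),
        IsNewformOf W f → ∀ (ϖ : ℚ), (ϖ : ℝ) * W.realPeriodRat = plusPeriod f →
      ∀ (D : W.SelmerDualData κ γ), D.IsTorsion ∧
        ∃ g : IwasawaAlgebra p, D.charIdeal = Ideal.span {g} ∧
          iwasawaToPowerSeries p g =
            PowerSeries.C (ϖ : ℚ_[p]) * padicLFunction f (unitRoot W p : ℚ_[p])) :
    ∃ q : ℚ, W.entireLFunction 1 / (W.realPeriodRat : ℂ) = (q : ℂ) ∧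
      padicValRat p q = (padicValNat p W.shaOrder : ℤ) + padicValNat p W.tamagawaProduct -
        2 * padicValNat p W.torsionOrder := by
  have hpP : p.Prime := Fact.out
  have hordp : IsOrdinaryAt W p := ⟨hgood, hord⟩
  -- Step 0 (modularity): the newform `f` of `E` at level `N_E` and the period ratio `ϖ`
  haveI : NeZero (W.conductorNorm ℤ) := ⟨(W.conductorNorm_pos_holds).ne'⟩
  obtain ⟨Dm⟩ := hmod W
  set f := Dm.f with hf_def
  have hf : IsNewformOf W f := Dm.isNewformOf
  obtain ⟨ϖ, hϖpos, hϖeq, hΩpos⟩ := Dm.exists_rat_mul_realPeriodRat_eq_plusPeriod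
  -- the rational number `q = ϖ · [0]⁺_f = L(E,1)/Ω_E`
  set s : ℚ := ratPlusSymbol f 0 with hs_def
  set t : ℚ := ϖ * s with ht_def
  have hLval : W.entireLFunction 1 = (((s : ℝ) * plusPeriod f : ℝ) : ℂ) := hf.entireLFunction_one_eq
  have hq : W.entireLFunction 1 / (W.realPeriodRat : ℂ) = ((t : ℚ) : ℂ) := by
    rw [hLval, ← hϖeq, div_eq_iff (Complex.ofReal_ne_zero.mpr hΩpos.ne'), ht_def]
    push_cast
    ring
  have hs0 : s ≠ 0 := by
    intro h0
    apply hL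
    rw [hLval, h0]
    simp
  have ht0 : t ≠ 0 := mul_ne_zero hϖpos.ne' hs0
  refine ⟨t, hq, ?_⟩
  -- Step 1 (the cyclotomic setting and the Iwasawa module)
  obtain ⟨κ, hκ, γ, hγ, hγ'⟩ := exists_isCyclotomic_isTopGenerator_isCyclotomicVariable_holds p
  obtain ⟨D⟩ := W.nonempty_selmerDualData_holds κ γ hγ
  haveI : Module.Finite (IwasawaAlgebra p) D.X := D.module_finite_holds hγ
  -- Step 2 (Mazur's main conjecture for `(E, p)`, Néron normalisation): `char X = (g)`,
  -- `ι g = ϖ · L_p(f, α)`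
  obtain ⟨hX, g, hchar, hιg⟩ := hMC κ γ hκ hγ hγ' f hf ϖ hϖeq D
  -- Step 3 (interpolation): `g(0) = ϖ · (1 - α⁻¹)² [0]⁺_f = (1 - α⁻¹)² · t`
  set a : ℚ_[p] := ((unitRoot W p : ℤ_[p]) : ℚ_[p]) with ha
  have htcast : ((t : ℚ) : ℚ_[p]) = (ϖ : ℚ_[p]) * (s : ℚ_[p]) := by
    rw [ht_def]; push_cast; ring
  have hg0 : ((PowerSeries.constantCoeff g : ℤ_[p]) : ℚ_[p]) = (1 - a⁻¹) ^ 2 * (t : ℚ_[p]) := by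
    rw [← constantCoeff_iwasawaToPowerSeries p g, hιg, map_mul, PowerSeries.constantCoeff_C,
      constantCoeff_padicLFunction_unitRoot hordp hf, htcast]
    ring
  -- the bridges `1 - α⁻¹ = u₂ · #Ẽ(𝔽_p)` and `#Ẽ(𝔽_p) = u₃ · #Ẽ(𝔽_p)(p)`; in particular `1 - α⁻¹ ≠ 0`
  obtain ⟨u₂, hu₂⟩ := exists_unit_one_sub_unitRoot_inv p W hordp
  haveI : NeZero p := ⟨hpP.ne_zero⟩
  obtain ⟨u₃, hu₃⟩ := exists_unit_natCard_eq_mul_card_primaryComponent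
    ((integralModelInt W).map (Int.castRingHom (ZMod p))).toAffine.Point p
  set Np : ℚ_[p] := (Nat.card (AddCommGroup.primaryComponent
    ((integralModelInt W).map (Int.castRingHom (ZMod p))).toAffine.Point p) : ℚ_[p]) with hNp
  have hNcount : (W.reductionPointCount p : ℚ_[p]) = ((u₃ : ℤ_[p]) : ℚ_[p]) * Np := by
    rw [WeierstrassCurve.reductionPointCount, hNp]
    exact hu₃
  have hNp0 : Np ≠ 0 := by
    rw [hNp]
    exact_mod_cast Nat.card_pos.ne'
  have h1 : (1 - a⁻¹) = ((u₂ : ℤ_[p]) : ℚ_[p]) * ((u₃ : ℤ_[p]) : ℚ_[p]) * Np := by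
    rw [hu₂, hNcount, mul_assoc]
  have htQ0 : (t : ℚ_[p]) ≠ 0 := by exact_mod_cast ht0
  have hU0 : ((u₂ : ℤ_[p]) : ℚ_[p]) * ((u₃ : ℤ_[p]) : ℚ_[p]) ≠ 0 :=
    mul_ne_zero (coe_units_ne_zero p u₂) (coe_units_ne_zero p u₃)
  -- Step 4 (finiteness, from the main conjecture): `g(0) ≠ 0`, so `X/TX`, `Sel_∞^Γ`, `Sel_{p^∞}(E/ℚ)`
  -- and `E(ℚ)` are finite (Greenberg p. 103 + Lemma 3.1); `Ш` is finite by hypothesis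
  have hg00 : PowerSeries.constantCoeff g ≠ 0 := by
    intro h
    rw [h, PadicInt.coe_zero, h1] at hg0
    exact (mul_ne_zero (pow_ne_zero 2 (mul_ne_zero hU0 hNp0)) htQ0) hg0.symm
  have hSelfin : Finite (W.selmerGroupPInfty p) :=
    D.finite_selmerGroupPInfty_of_constantCoeff_ne_zero W hγ hX g hchar hg00
  obtain ⟨hEfin, hShapfin⟩ := (W.finite_selmerGroupPInfty_iff p).mp hSelfin
  haveI := hEfin
  haveI := hShapfin
  haveI := hSelfin
  haveI : Finite W.sha := hfin
  -- Step 5 (Greenberg's Thm. 4.1)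
  obtain ⟨u₁, hu₁⟩ := hGr κ γ hκ hγ hγ' D hX g hchar hSelfin
  -- Step 6 (the remaining bridges)
  obtain ⟨u₄, hu₄⟩ := exists_unit_torsionOrder_eq W p
  obtain ⟨u₅, hu₅⟩ := exists_unit_natCard_eq_mul_card_primaryComponent W.sha p
  have hSel : Nat.card (W.selmerGroupPInfty p) = Nat.card (AddCommGroup.primaryComponent W.sha p) :=
    W.natCard_selmerGroupPInfty_eq_natCard_primaryComponent_sha p
  -- abbreviations
  set v := padicValNat p W.tamagawaProduct with hv
  set Tp : ℚ_[p] := (Nat.card (AddCommGroup.primaryComponent W.toAffine.Point p) : ℚ_[p]) with hTp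
  set Shp : ℚ_[p] := (Nat.card (AddCommGroup.primaryComponent W.sha p) : ℚ_[p]) with hShp
  -- `#E(ℚ)_tors = u₄ · Tp` (up to the `DecidableEq ℚ` instance inside the group law)
  have hu₄' : (W.torsionOrder : ℚ_[p]) = ((u₄ : ℤ_[p]) : ℚ_[p]) * Tp := by
    rw [hu₄, hTp]
    congr 1
    exact_mod_cast natCard_primaryComponent_point_congr W p _ _
  -- `#Ш = u₅ · Shp`, `#Sel = Shp`
  have hSha : (W.shaOrder : ℚ_[p]) = ((u₅ : ℤ_[p]) : ℚ_[p]) * Shp := by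
    rw [WeierstrassCurve.shaOrder, hShp]
    exact hu₅
  have hSel' : (Nat.card (W.selmerGroupPInfty p) : ℚ_[p]) = Shp := by rw [hShp, hSel]
  -- Step 7: the identity `t · Tp² · (u₂ u₃)² = u₁ · p^v · Shp` in `ℚ_p`
  have key : (t : ℚ_[p]) * Tp ^ 2 * (((u₂ : ℤ_[p]) : ℚ_[p]) * ((u₃ : ℤ_[p]) : ℚ_[p])) ^ 2 =
      ((u₁ : ℤ_[p]) : ℚ_[p]) * (p : ℚ_[p]) ^ v * Shp := by
    apply mul_right_cancel₀ (pow_ne_zero 2 hNp0)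
    calc (t : ℚ_[p]) * Tp ^ 2 * (((u₂ : ℤ_[p]) : ℚ_[p]) * ((u₃ : ℤ_[p]) : ℚ_[p])) ^ 2 * Np ^ 2
        = ((1 - a⁻¹) ^ 2 * (t : ℚ_[p])) * Tp ^ 2 := by rw [h1]; ring
      _ = ((u₁ : ℤ_[p]) : ℚ_[p]) * (p : ℚ_[p]) ^ v * Np ^ 2 * (Nat.card (W.selmerGroupPInfty p) : ℚ_[p]) := by
          rw [← hg0, hu₁]
      _ = ((u₁ : ℤ_[p]) : ℚ_[p]) * (p : ℚ_[p]) ^ v * Shp * Np ^ 2 := by rw [hSel']; ring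
  -- Step 8: valuations
  have hTp0 : Tp ≠ 0 := by rw [hTp]; exact_mod_cast Nat.card_pos.ne'
  have hShp0 : Shp ≠ 0 := by rw [hShp]; exact_mod_cast Nat.card_pos.ne'
  have hp0 : (p : ℚ_[p]) ≠ 0 := Nat.cast_ne_zero.mpr hpP.ne_zero
  have hval := congrArg Padic.valuation key
  rw [Padic.valuation_mul (mul_ne_zero htQ0 (pow_ne_zero 2 hTp0)) (pow_ne_zero 2 hU0),
    Padic.valuation_mul htQ0 (pow_ne_zero 2 hTp0), Padic.valuation_pow, Padic.valuation_pow,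
    Padic.valuation_mul (coe_units_ne_zero p u₂) (coe_units_ne_zero p u₃),
    valuation_coe_units_eq_zero, valuation_coe_units_eq_zero,
    Padic.valuation_mul (mul_ne_zero (coe_units_ne_zero p u₁) (pow_ne_zero v hp0)) hShp0,
    Padic.valuation_mul (coe_units_ne_zero p u₁) (pow_ne_zero v hp0), valuation_coe_units_eq_zero,
    Padic.valuation_pow, Padic.valuation_p, Padic.valuation_ratCast] at hval
  -- `v(Tp) = v(#E(ℚ)_tors)`, `v(Shp) = v(#Ш)`
  have hvT : Tp.valuation = (padicValNat p W.torsionOrder : ℤ) := by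
    have h := congrArg Padic.valuation hu₄'
    rw [Padic.valuation_natCast, Padic.valuation_mul (coe_units_ne_zero p u₄) hTp0,
      valuation_coe_units_eq_zero, zero_add] at h
    exact h.symm
  have hvS : Shp.valuation = (padicValNat p W.shaOrder : ℤ) := by
    have h := congrArg Padic.valuation hSha
    rw [Padic.valuation_natCast, Padic.valuation_mul (coe_units_ne_zero p u₅) hShp0,
      valuation_coe_units_eq_zero, zero_add] at h
    exact h.symm
  rw [hvT, hvS] at hval
  simp only [Nat.cast_ofNat, mul_zero, add_zero, zero_add] at hval
  linarith

/-- **From the print shape to Miller's `BSD(E,p)` in analytic rank `0`.** If `ord_{s=1} L(E,s) = 0`,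
`L(E,1) ≠ 0`, and `L(E,1)/Ω_E` is a rational `q` with `ord_p q = ord_p #Ш + ord_p ∏ c_ℓ - 2 ord_p #E(ℚ)_tors`
(the shape of bsd.S30 / Keller–Yin Thm. 4.2.1 in rank `0`), then `BSD(E,p)` in the sense of
Miller, LMS J. Comput. Math. 14 (2011), Def. 1.1 (`BSDp W p`): the rank part and the finiteness of
`Ш` are Gross–Zagier–Kolyvagin (bsd.S17, the named fact `rank_eq_analyticRank_of_analyticRank_le_one`,
hypothesis `hGZK`), `Reg(E/ℚ) = 1` in rank `0` (`regulator_eq_one_of_rank_zero`),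
`L^{(0)}(E,1)/0! = L(E,1)` (`leadingLCoeff_eq_of_analyticRank_eq_zero`), so
`#Ш_an = q · #E(ℚ)_tors² / ∏ c_ℓ` is rational with `ord_p #Ш_an = ord_p #Ш = ord_p #Ш[p^∞]`
(`padicValNat_card_addPrimaryComponent`). Miller, loc. cit., §1: "If `r_an(E/ℚ) ≤ 1` then all but
the last part of `BSD(E/ℚ,p)` is known, so in this case `BSD(E/ℚ,p)` is equivalent to the last
equality". [cite: Miller2011LMS, Def. 1.1 and §1 (arXiv:1010.2431 p. 3)] -/
theorem bsdp_of_padicValRat_rank_zero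
    (W : WeierstrassCurve ℚ) [W.IsElliptic] [W.IsGloballyMinimal] (p : ℕ) [Fact p.Prime]
    (hr : W.analyticRank = 0) (hL : W.entireLFunction 1 ≠ 0)
    (hGZK : rank_eq_analyticRank_of_analyticRank_le_one)
    (hq : ∃ q : ℚ, W.entireLFunction 1 / (W.realPeriodRat : ℂ) = (q : ℂ) ∧
      padicValRat p q = (padicValNat p W.shaOrder : ℤ) + padicValNat p W.tamagawaProduct -
        2 * padicValNat p W.torsionOrder) :
    BSDp W p := by
  have hpP : p.Prime := Fact.out
  obtain ⟨hrank, hfin⟩ := hGZK W (by omega)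
  haveI : Finite W.sha := hfin
  obtain ⟨q, hqL, hqv⟩ := hq
  have hΩ : 0 < W.realPeriodRat := W.realPeriodRat_pos_holds
  have hΩC : (W.realPeriodRat : ℂ) ≠ 0 := Complex.ofReal_ne_zero.mpr hΩ.ne'
  have hT : 0 < W.torsionOrder := W.torsionOrder_pos_holds
  have hc : 0 < W.tamagawaProduct := W.tamagawaProduct_pos'
  have hS : 0 < W.shaOrder := W.shaOrder_pos hfin
  have hL1 : W.entireLFunction 1 = (q : ℂ) * (W.realPeriodRat : ℂ) := by
    rw [← hqL, div_mul_cancel₀ _ hΩC]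
  have hq0 : q ≠ 0 := by
    rintro rfl
    apply hL
    rw [hL1]
    simp
  have hr0 : W.mordellWeilRank = 0 := hrank.trans hr
  have hReg : W.regulator = 1 := W.regulator_eq_one_of_rank_zero hr0
  -- `#Ш_an = q · #E(ℚ)_tors² / ∏ c_ℓ`
  set q' : ℚ := q * (W.torsionOrder : ℚ) ^ 2 / (W.tamagawaProduct : ℚ) with hq'
  have hsha : shaAn W = ((q' : ℚ) : ℂ) := by
    rw [shaAn_def, W.leadingLCoeff_eq_of_analyticRank_eq_zero hr, hL1, hReg, hq']
    have hcC : ((W.tamagawaProduct : ℚ) : ℂ) ≠ 0 := by exact_mod_cast hc.ne'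
    push_cast
    field_simp
  refine ⟨hrank, inferInstance, q', hsha, ?_⟩
  -- valuations
  have hT0 : (W.torsionOrder : ℚ) ≠ 0 := by exact_mod_cast hT.ne'
  have hc0 : (W.tamagawaProduct : ℚ) ≠ 0 := by exact_mod_cast hc.ne'
  rw [hq', padicValRat.div (mul_ne_zero hq0 (pow_ne_zero 2 hT0)) hc0,
    padicValRat.mul hq0 (pow_ne_zero 2 hT0), padicValRat.pow, hqv,
    padicValNat_card_addPrimaryComponent (A := W.sha) p, padicValRat.of_nat, padicValRat.of_nat]
  simp only [WeierstrassCurve.shaOrder]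
  ring

end EisensteinRankZero

end Literature.NumberTheory.EllipticCurves

end
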